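import Summits.QuantumFields.YangMills.Theorems.BalabanUVNodesN19TubeDecayAtU3PinFromLetters
import Summits.QuantumFields.YangMills.Theorems.BalabanUVNodesN19UniformLettersAtU3Pin

/-!
# BalabanUVNodes ∕ N19 — WHAT STUB 1's FACE `PHolderD4` READS BACK OF THE N19′ FACE's NODE-U3 INPUTS INSIDE `stub_expansion13HV`:
# the face is SHIFT-BLIND, (T) is not — so (T) is NOT a function of the face; at the (t-U3) pin, modulo the face, (T) ⟺ the (5.10)-type
# letter at every direction pair and `hunif` ⟺ the one bit `0 < ρ`

Cell `pub-ymgap`, HUMAN RULING D-0062 (Track A) ∕ D-0149 ∕ D-0154 (director-ym R399 (3a)), width seat `pub-ymgap-dag-n19-w5` (harness re-mint g2 of the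
g0∕g1 lineage FILES 1–7), FILE 8.  THEOREMS ONLY (0 `def`, 0 `instance`, 0 `sorry`); imports this seat's FILE 3 `BalabanUVNodesN19TubeDecayAtU3PinFromLetters`
and FILE 5 `BalabanUVNodesN19UniformLettersAtU3Pin` ONLY (mirror-free: NO Theses, NO `K3V6Defs` — the face's body is SPELLED); modifies nothing;
`--kind proof --supports` K3⁸ `SpineGivenEndpointR13SepCoPHV` (stmt-QuantumFields-27366) `--as helper` — COUNT-NEUTRAL.

WHY.  K3⁸'s registered skeleton «v6» (b4e55110ab73e679) splits the line into `stub_rates13HV` (∃ reading, `GuardedReadingN16 … ∧ KeyedRatesHolderD4V β (rrOfRecord 𝔯 ksel)`)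
and `stub_expansion13HV` (∀ reading, `GuardedReadingN16 … → KeyedRatesHolderD4V β (rrOfRecord 𝔯 ksel) → ∃ jc sh cr, … ∧ KeyedCoreEdgeHolderD4V β cr (rrOfRecord 𝔯 ksel)`).
The closer of stub 2 — equivalently of dag-n27-w1's letter form `K3V6Defs.stub2TextV_iff_letterFormV` (p-landed `…K3V6StubsLetterForm`), which quantifies over EVERY
letter reading `ℓ` — is handed stub 1's FACE: per tuple, inside `ForSmallCouplings`, `PHolderD4 β D R` = `RatesHolderAt D R β ∧ ReadOutAt D R.u3 ∧ (0 ≤ R.u3.ρ ∧ R.u3.ρ < 1)`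
at `R := rateCarriersOfRecord₁₃CoPH 𝔯 F θ hP g₀ os (ksel …)` (it is also the antecedent of the N19′ face's own body).  It is NOT handed stub 1's LETTER ROWS
`hs : (ℓ F θ).Signs`, `hL`, `h9`, `hW` (those are hypotheses of stub 1's PRODUCER road, `K3V6Defs.keyedRatesHolderD4BFree_rrOfRecord_of_pins_of_letters`).  Every N19′-face
producer of record keys the face's two node-U3 inputs on ROWS: the uniform-letters clause `hunif` ⟸ `hs` (FILE 5 `hunif_of_u3Pinned_of_signs`) and the bundle decay letter
(T) `hdecT : … ∃ E₀ ≥ 0, DecayBound R.u3.EA (Window γ) E₀ R.u3.κ` ⟸ `hs hL h9` + W1's (5.10) letter at ALL 16 pairs (FILE 6 `hdecT_of_u3Pinned_of_stub1Rows`; dag-n19-w3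
p614196 · p618248 · p623655 · p626083 · p634293 · p636214 consume them BY NAME).  THE READ-BACK QUESTION: inside stub 2 AS REGISTERED, which of the two inputs does the FACE
determine?

WHAT.
* §1 [folklore] SHIFT-BLINDNESS, generic `T4OutputRate.Carriers`: under `EA ↦ EA + c` and `EB b ↦ EB b + c` every node-U3 conjunct of the face is preserved —
  `ne9_shift_const` (NE9 reads coupling DIFFERENCES), `ne5_shift_const` (NE5 reads the two runs' DIFFERENCE), `readOutAt_shift_const` ((D4): re-centre the two
  read-out recipes `r k S := r k (S − c)` and translate the two slice classes; `RepresentsA∕B`, `ReadBoundedOn`, `ReadCovariantOn` read differences; the six letter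
  signs do not read `EA`), `n17At_shift_const_iff` (N17 reads the datum and the letters only), `n18At_shift_const`, `n22At_shift_const` (fading memory does not read `EA`);
  ★ `u3Faces_shift_const`; ★★ `pHolderD4Body_shift_const` — the face's BODY `RatesHolderAt D R β ∧ ReadOutAt D R.u3 ∧ (0 ≤ R.u3.ρ ∧ R.u3.ρ < 1)` (dag-n27-w1's
  `K3V6Defs.PHolderD4 β D R` SPELLED; N14∕N15∕N16 components untouched) holds at the shifted bundle `{R with u3 := {R.u3 with EA := EA + c, EB := EB · + c}}`.
* §2 [folklore] (T) IS NOT SHIFT-BLIND: `not_decayBound_shift_const` — on carriers with domains of unbounded size `d`, `0 < κ`, a non-empty coupling set and a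
  background, `DecayBound E W E₀ κ` and `c ≠ 0` forbid `DecayBound (E + c) W E₀' κ` for EVERY `E₀'` (`|c| ≤ (|E₀| + |E₀'|)·e^{−κ d(X)}` at a large domain, `t + 1 ≤ eᵗ`).
* §3 [bookkeeping] ★★★ THE NO-GO `not_forall_pHolderD4Body_imp_decayBound` (HYPOTHESIS FORM): if ONE bundle `R` carries the face at `(D, β)` together with (T) on a non-empty
  coupling set `W` at rate `0 < R.u3.κ` (unbounded sizes, a run-A background), then «face ⇒ (T) on `W`» FAILS on the rate-carrier type — the shifted bundle carries the face
  (§1) and no decay bound (§2).  So (T) is NOT a function of stub 1's face: a closer of `stub_expansion13HV` cannot read `hdecT` off `KeyedRatesHolderD4V`.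
* §4 [bookkeeping] AT THE (t-U3) PIN (`U3PinnedKernels 𝔯 ℓ` unfolded per tuple, as in FILES 2–7), WHAT THE FACE DOES READ BACK: `rho_row_of_face_of_u3Pinned` (the face's
  ρ-row at ONE tuple IS the letter row `0 ≤ (ℓ F θ).ρ < 1` — FILE 5's `rfl` faces); ★ `hunif_iff_rho_pos_of_face_of_u3Pinned` (modulo the face somewhere on each guarded
  admissible tuple, the consumers' VERBATIM `hunif` ⟺ the ONE-BIT row `∀ F θ hP, G θ → θ.Admissible F N → 0 < (ℓ F θ).ρ`; FILE 5 `hunif_iff_rho_row_of_u3Pinned` BY NAME);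
  ★★ `decayBound_iff_kernelDecayOfRecord₁₃_of_face_of_u3Pinned` ∕ `…_of_pHolderD4Body_of_u3Pinned` (modulo the face AT the tuple — its `N22At`, the `ReadOutAt` signs
  `0 ≤ ω ≤ ρ`, `ρ < 1` and fading memory's `0 ≤ C₉` are EXACTLY FILE 3's side letters — (T) at the record window ⟺ W1's (5.10)-type letter
  `KernelDecayOfRecord₁₃ F N θ μ ν (ℓ F θ).κ` at ALL 16 direction pairs; FILE 3 `decayBound_atPin_iff_kernelDecayOfRecord₁₃` BY NAME); ★ `hdecTAt_iff_kernelDecayOfRecord₁₃_of_face_of_u3Pinned`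
  (the consumers' per-tuple `hdecT` body «every tuning window `γ' ≤ θ.γ`» ⟺ the same letter).
* §5 [bookkeeping] AT A PINNED TUPLE the no-go's carrier hypotheses HOLD (def-W1's kernel carriers: `unbounded_d_atPin` — `|z|₁ = 4⌈r⌉₊ ≥ r` — and the `PUnit` background):
  ★★★ `not_forall_face_imp_decayBound_of_u3Pinned` (face + (T) at one pinned tuple, `0 < ℓ.κ`, `0 < γ` ⇒ «face ⇒ (T)» fails over bundles) and
  ★★★ `…_of_kernelDecay` (the same with (T) READ from the record's (5.10)-type letter ∀μν by §4, window `Window θ.γ` on an admissible tuple).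

LOCATED (count-neutral; for the plan's K3 v7 precut and the N19′ ∕ N27 composites' honesty paragraphs — numbers, not adjectives).  Node U3's face inside `PHolderD4`
(`N18At` = NE5, `N22At` = NE9 ∧ fading memory, `ReadOutAt` = the (D4) read-out binders, the ρ-row; `N17At` reads the datum) is a list of DIFFERENCE statements, blind to
`EA ↦ EA + c` (§1); the PRINTED decay binder [Balaban1987RG1] (1.18) p. 263 `T4OutputRate.DecayBound` — under the kernel pin the windowed (5.10) p. 293 letter at every
direction pair (FILE 3) — is NOT among them, and the N19′ chain consumes it as `hdecT` (the link reading's tube block (T), FILE 2 `tube_of_pin`).  Hence inside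
`stub_expansion13HV` AS REGISTERED the (T) input is neither displayed nor derivable from stub 1's conclusion (§3); modulo the face it IS the record's (5.10)-type letter at
rate `(ℓ F θ).κ`, all 16 pairs (§4) — a node-W1 sentence about the record, of the same kind as stub 1's bill rows `hL h9 hW`.  One-line repairs, either of: (a) add the printed
binder `∃ E₀ ≥ 0, DecayBound u.EA u.W E₀ u.κ` to node U3's face on the carriers (then the 16-pair letter `hWall` moves to stub 1's bill next to `hL h9 hW`, supplied at the pin by
FILE 3∕4, and `hdecT` leaves every N19′ composite); (b) display `hWall` as a stub-2-side row.  The other node-U3 input `hunif` needs NO row beyond the face except the bit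
`0 < ρ` (the face carries `0 ≤ ρ`).

HONEST FRAMING.  Elementary translation bookkeeping (`add_sub_add_right_eq_sub`, `t + 1 ≤ eᵗ`) over HYPOTHESIS shapes and by-name `Iff`s; ZERO estimate content; the no-go of
§3 is CONDITIONAL on an inhabitant of the face carrying (T) (A6: the face is inhabited for no family today; the MECHANISM §1–§2 is unconditional); nothing of Bałaban's
asserted or instantiated; NE5 ∕ NE9 ∕ (5.10)-at-the-record ∕ NE7 NOT PRINTED as two-run statements for d = 4 and NOT proved; no stub closed — NOT `stub_rates13HV`, NOT
`stub_expansion13HV`; N14 ∕ N18 ∕ N19 ∕ N22 NOT discharged; K3⁸ OPEN, skeleton v6 UNTOUCHED; K3⁷ aside; counts UNMOVED (typed 28∕28 · discharged 5∕27 · A 5∕28).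
One finite 𝕋⁴ at fixed ε — R4 closes the CONDITIONAL rung `BalabanLadder.UV` only; NOT ℝ⁴ ∕ continuum ∕ OS; the Yang–Mills mass gap (Clay) is NOT proved by any of this.
[folklore] ∕ [bookkeeping] throughout.
-/

noncomputable section

namespace Summit.QuantumFields.YangMills.BalabanUVNodes.N19U3InputsReadBackFromStub1Face

open Literature.MathematicalPhysics.QuantumFieldTheory.Balaban1983to89
open Literature.MathematicalPhysics.QuantumFieldTheory.Balaban1983to89.T4Continuum (T4Family ULoop)
open Literature.MathematicalPhysics.QuantumFieldTheory.Balaban1983to89.T4OutputRate (Carriers Functional Window DecayBound NE5 NE9 FadingMemory)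
open Literature.MathematicalPhysics.QuantumFieldTheory.Balaban1983to89.T4BetaReadOut (Slice ReadOut RepresentsA RepresentsB SliceClose)
open Literature.MathematicalPhysics.QuantumFieldTheory.Balaban1983to89.T4BetaReadOutLipschitz (ReadBoundedOn ReadCovariantOn)
open Literature.MathematicalPhysics.QuantumFieldTheory.Balaban1983to89.Node00 (Stage13Params Stage13HParams U3Letters₁₁ datumOfRecord₁₃CoPH)
open Literature.MathematicalPhysics.QuantumFieldTheory.Balaban1983to89.Node00.U3OfKernels (objectsOfRecord₁₃ KernelDecayOfRecord₁₃)
open YMDAG.UVSplit (Datum U3Carriers RateCarriers RateReading₁₃CoPH N17At N18At N22At ReadOutAt u3OfRecord₁₃ rateCarriersOfRecord₁₃CoPH)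
open Summit.QuantumFields.YangMills.BalabanUVNodes.SpineRatesHolder (RatesHolderAt)
open Summit.QuantumFields.YangMills.BalabanUVNodes.N19LinkReadingAtU3Pin (u3_rateCarriersOfRecord₁₃CoPH_of_pin decayBound_window_mono window_mono)
open Summit.QuantumFields.YangMills.BalabanUVNodes.N19TubeDecayAtU3PinFromLetters (decayBound_atPin_iff_kernelDecayOfRecord₁₃ n22At_atPin_iff)
open Summit.QuantumFields.YangMills.BalabanUVNodes.N19UniformLettersAtU3Pin (hunif_iff_rho_row_of_u3Pinned)
open Summit.QuantumFields.YangMills.BalabanUVNodes.N19RateEdgeRecordRunLetters (signs_of_readOutAt)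

/-! ## §1 The face's node-U3 conjuncts are SHIFT-BLIND -/

section Shift

variable {C : Carriers}

/-- **NE9 IS SHIFT-BLIND** [folklore]: the joint-Lipschitz history bound reads only DIFFERENCES `E g U X − E g' U X`, so it survives `E ↦ E + c`. -/
theorem ne9_shift_const {Bg : Type} {E : Functional C Bg} {W : Set (ℕ → ℝ)} {κ : ℝ} {Λ : ℕ → ℕ → ℝ} (h : NE9 E W κ Λ) (c : ℝ) :
    NE9 (fun g U X => E g U X + c) W κ Λ := fun g hg g' hg' U X => by
  simpa only [add_sub_add_right_eq_sub] using h g hg g' hg' U X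

/-- **NE5 IS SHIFT-BLIND** [folklore]: the η-rate reads only the DIFFERENCE of the two runs' terms, so it survives the simultaneous shift of both. -/
theorem ne5_shift_const {EA : Functional C C.BgA} {EB : Functional C C.BgB} {W : Set (ℕ → ℝ)} {κ θ C₅ : ℝ} (h : NE5 EA EB W κ θ C₅) (c : ℝ) :
    NE5 (fun g U X => EA g U X + c) (fun g U X => EB g U X + c) W κ θ C₅ := fun g hg U X => by
  simpa only [add_sub_add_right_eq_sub] using h g hg U X

variable {F : T4Family} {N : ℕ} [NeZero N]

/-- **THE (D4) READ-OUT BINDERS ARE SHIFT-BLIND** [folklore]: `ReadOutAt D u` survives `EA ↦ EA + c`, `EB b ↦ EB b + c` — re-centre both recipes (`r k S := r k (S − c)`),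
translate both slice classes by `c`; `RepresentsA∕B` then read the same numbers, `ReadBoundedOn` ∕ `ReadCovariantOn` read slice DIFFERENCES, and the six letter signs do
not read the functionals. -/
theorem readOutAt_shift_const (D : Datum F N) {u : U3Carriers} (h : ReadOutAt D u) (c : ℝ) :
    ReadOutAt D { u with EA := fun g U X => u.EA g U X + c, EB := fun b g U X => u.EB b g U X + c } := by
  obtain ⟨𝒜A, 𝒜B, rA, rB, hW, hA, hB, h𝒜A, h𝒜B, hr, hcov, hcr, hC₅, hθ, hω, hθρ, hωρ⟩ := h
  refine ⟨{S | (fun U X => S U X - c) ∈ 𝒜A}, {S | (fun U X => S U X - c) ∈ 𝒜B}, fun k S => rA k (fun U X => S U X - c),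
    fun k S => rB k (fun U X => S U X - c), hW, ?_, ?_, ?_, ?_, ?_, ?_, hcr, hC₅, hθ, hω, hθρ, hωρ⟩
  · intro k v hv
    simp only [add_sub_cancel_right]
    exact hA k v hv
  · intro k w hw
    simp only [add_sub_cancel_right]
    exact hB k w hw
  · intro g hg
    simp only [Set.mem_setOf_eq, add_sub_cancel_right]
    exact h𝒜A g hg
  · intro b hb hbγ g hg
    simp only [Set.mem_setOf_eq, add_sub_cancel_right]
    exact h𝒜B b hb hbγ g hg
  · intro k S S' M hS hS' hSS'
    exact hr k _ _ M hS hS' fun U X hX => by simpa only [sub_sub_sub_cancel_right] using hSS' U X hX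
  · intro k S S' M hS hS' hSS'
    exact hcov k _ _ M hS hS' fun U X hX => by simpa only [sub_sub_sub_cancel_right] using hSS' U X hX

/-- **N17's slot does not read the functionals** (`Iff.rfl`): `N17At D u` is the datum's scale-shift rate at the letters `cr·C₅·θ, ρ, γ`. [folklore] -/
theorem n17At_shift_const_iff (D : Datum F N) (u : U3Carriers) (c : ℝ) :
    N17At D { u with EA := fun g U X => u.EA g U X + c, EB := fun b g U X => u.EB b g U X + c } ↔ N17At D u :=
  Iff.rfl

/-- **N18's slot (NE5 at every member of run B's family) IS SHIFT-BLIND** [folklore]. -/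
theorem n18At_shift_const {u : U3Carriers} (h : N18At u) (c : ℝ) :
    N18At { u with EA := fun g U X => u.EA g U X + c, EB := fun b g U X => u.EB b g U X + c } :=
  fun b hb hbγ => ne5_shift_const (h b hb hbγ) c

/-- **N22's slot (NE9 ∧ fading memory) IS SHIFT-BLIND** [folklore] (fading memory reads the moduli only). -/
theorem n22At_shift_const {u : U3Carriers} (h : N22At u) (c : ℝ) :
    N22At { u with EA := fun g U X => u.EA g U X + c, EB := fun b g U X => u.EB b g U X + c } :=
  ⟨ne9_shift_const h.1 c, h.2⟩

/-- ★ **EVERY NODE-U3 CONJUNCT OF STUB 1's FACE IS SHIFT-BLIND** [bookkeeping]: (D4) ∧ N17 ∧ N18 ∧ N22 ∧ the ρ-row at `u` give the same at the shifted bundle. -/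
theorem u3Faces_shift_const (D : Datum F N) {u : U3Carriers} (h : ReadOutAt D u ∧ N17At D u ∧ N18At u ∧ N22At u ∧ (0 ≤ u.ρ ∧ u.ρ < 1)) (c : ℝ) :
    ReadOutAt D { u with EA := fun g U X => u.EA g U X + c, EB := fun b g U X => u.EB b g U X + c } ∧
      N17At D { u with EA := fun g U X => u.EA g U X + c, EB := fun b g U X => u.EB b g U X + c } ∧
      N18At { u with EA := fun g U X => u.EA g U X + c, EB := fun b g U X => u.EB b g U X + c } ∧
      N22At { u with EA := fun g U X => u.EA g U X + c, EB := fun b g U X => u.EB b g U X + c } ∧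
      (0 ≤ u.ρ ∧ u.ρ < 1) :=
  ⟨readOutAt_shift_const D h.1 c, (n17At_shift_const_iff D u c).2 h.2.1, n18At_shift_const h.2.2.1 c, n22At_shift_const h.2.2.2.1 c, h.2.2.2.2⟩

/-- ★★ **STUB 1's FACE BODY `PHolderD4 β D R` (SPELLED) IS SHIFT-BLIND** [bookkeeping]: `RatesHolderAt D R β ∧ ReadOutAt D R.u3 ∧ (0 ≤ R.u3.ρ ∧ R.u3.ρ < 1)` — dag-n27-w1's
`K3V6Defs.PHolderD4 β D R` unfolded, the per-tuple content of `KeyedRatesHolderD4V` ∕ of the N19′ face's antecedent — holds at the bundle whose node-U3 functionals are shifted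
by any constant `c` (N14 ∕ N15 ∕ N16 components and all letters untouched). -/
theorem pHolderD4Body_shift_const (D : Datum F N) (R : RateCarriers N) (β : ℝ)
    (h : RatesHolderAt D R β ∧ ReadOutAt D R.u3 ∧ (0 ≤ R.u3.ρ ∧ R.u3.ρ < 1)) (c : ℝ) :
    RatesHolderAt D { R with u3 := { R.u3 with EA := fun g U X => R.u3.EA g U X + c, EB := fun b g U X => R.u3.EB b g U X + c } } β ∧
      ReadOutAt D { R.u3 with EA := fun g U X => R.u3.EA g U X + c, EB := fun b g U X => R.u3.EB b g U X + c } ∧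
      (0 ≤ R.u3.ρ ∧ R.u3.ρ < 1) := by
  obtain ⟨⟨h14, h15, h16, h17, h18, h22⟩, hD4, hρ⟩ := h
  exact ⟨⟨h14, h15, h16, (n17At_shift_const_iff D R.u3 c).2 h17, n18At_shift_const h18 c, n22At_shift_const h22 c⟩, readOutAt_shift_const D hD4 c, hρ⟩

end Shift

/-! ## §2 (T) `DecayBound` is NOT shift-blind -/

section NotBlind

variable {C : Carriers} {Bg : Type}

/-- **(T) IS NOT SHIFT-BLIND** [folklore]: on carriers with domains of unbounded size, at a positive rate, with a non-empty coupling set and some background, a decay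
bound for `E` and `c ≠ 0` forbid any decay bound for `E + c`: at a domain `X` with `κ·d(X)` large, `|c| ≤ (|E₀| + |E₀'|)·e^{−κ d(X)}` contradicts `t + 1 ≤ eᵗ`. -/
theorem not_decayBound_shift_const (hB : Nonempty Bg) {E : Functional C Bg} {W : Set (ℕ → ℝ)} {E₀ κ : ℝ}
    (hd : ∀ r : ℝ, ∃ X : C.Dom, r ≤ C.d X) (hκ : 0 < κ) (hW : W.Nonempty) (h : DecayBound E W E₀ κ) {c : ℝ} (hc : c ≠ 0) (E₀' : ℝ) :
    ¬ DecayBound (fun g U X => E g U X + c) W E₀' κ := by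
  intro h'
  obtain ⟨g, hg⟩ := hW
  obtain ⟨U⟩ := hB
  have hc0 : 0 < |c| := abs_pos.mpr hc
  set S : ℝ := |E₀| + |E₀'| with hS
  have hS0 : 0 ≤ S := add_nonneg (abs_nonneg _) (abs_nonneg _)
  obtain ⟨X, hX⟩ := hd (S / (κ * |c|) + 1)
  set t : ℝ := κ * C.d X with ht
  -- the shift is squeezed between the two decay bounds at `X`
  have hcle : |c| ≤ S * Real.exp (-t) := by
    have h1 := h g hg U X
    have h2 := h' g hg U X
    have he : 0 ≤ Real.exp (-t) := (Real.exp_pos _).le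
    calc |c| = |(E g U X + c) - E g U X| := by ring_nf
      _ ≤ |E g U X + c| + |E g U X| := abs_sub _ _
      _ ≤ E₀' * Real.exp (-(κ * C.d X)) + E₀ * Real.exp (-(κ * C.d X)) := add_le_add h2 h1
      _ ≤ |E₀'| * Real.exp (-t) + |E₀| * Real.exp (-t) :=
          add_le_add (mul_le_mul_of_nonneg_right (le_abs_self _) he) (mul_le_mul_of_nonneg_right (le_abs_self _) he)
      _ = S * Real.exp (-t) := by rw [hS]; ring
  -- `t` is large: `κ·r ≤ t` with `κ·r = S/|c| + κ`
  have hκr : S / |c| + κ ≤ t := by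
    have h1 : κ * (S / (κ * |c|) + 1) ≤ t := by rw [ht]; exact mul_le_mul_of_nonneg_left hX hκ.le
    have h2 : κ * (S / (κ * |c|) + 1) = S / |c| + κ := by field_simp
    linarith
  have ht0 : 0 < t + 1 := by
    have : 0 ≤ S / |c| := div_nonneg hS0 hc0.le
    linarith
  -- `e^{-t} (t + 1) ≤ 1`
  have hexp : Real.exp (-t) * (t + 1) ≤ 1 := by
    have h1 : t + 1 ≤ Real.exp t := Real.add_one_le_exp t
    have h2 : Real.exp (-t) * Real.exp t = 1 := by rw [← Real.exp_add]; simp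
    calc Real.exp (-t) * (t + 1) ≤ Real.exp (-t) * Real.exp t := mul_le_mul_of_nonneg_left h1 (Real.exp_pos _).le
      _ = 1 := h2
  -- contradiction: `|c| (t+1) ≤ S e^{-t} (t+1) ≤ S < |c| (t+1)`
  have hle : |c| * (t + 1) ≤ S := by
    calc |c| * (t + 1) ≤ S * Real.exp (-t) * (t + 1) := mul_le_mul_of_nonneg_right hcle ht0.le
      _ = S * (Real.exp (-t) * (t + 1)) := by ring
      _ ≤ S * 1 := mul_le_mul_of_nonneg_left hexp hS0
      _ = S := mul_one _
  have hgt : S < |c| * (t + 1) := by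
    have h1 : |c| * (S / |c| + κ + 1) ≤ |c| * (t + 1) := mul_le_mul_of_nonneg_left (by linarith) hc0.le
    have h2 : |c| * (S / |c| + κ + 1) = S + |c| * (κ + 1) := by
      field_simp
      ring
    have h3 : 0 < |c| * (κ + 1) := mul_pos hc0 (by linarith)
    linarith
  exact absurd hle (not_le.mpr hgt)

end NotBlind

/-! ## §3 THE NO-GO: (T) is not a function of stub 1's face -/

section NoGo

variable {F : T4Family} {N : ℕ} [NeZero N]

/-- ★★★ **(T) IS NOT A FUNCTION OF STUB 1's FACE** [bookkeeping] (hypothesis form): let ONE rate-carrier bundle `R` carry the face's body at `(D, β)` AND a (T) decay bound on a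
non-empty coupling set `W` at rate `0 < R.u3.κ`, on carriers with domains of unbounded size and some run-A background.  Then «the face ⇒ (T) on `W`» is FALSE as a
statement over bundles: the shifted bundle (`EA + 1`, `EB · + 1`) carries the face (§1 `pHolderD4Body_shift_const`) and no decay bound for any constant (§2).  Consequence for
`stub_expansion13HV`: its closer cannot read the N19′ chain's `hdecT` off `KeyedRatesHolderD4V β (rrOfRecord 𝔯 ksel)`.  CONDITIONAL on the displayed inhabitant (A6: the
face is inhabited for no family today). -/
theorem not_forall_pHolderD4Body_imp_decayBound (D : Datum F N) (β : ℝ) (W : Set (ℕ → ℝ)) (hW : W.Nonempty)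
    (R : RateCarriers N) (hB : Nonempty R.u3.C.BgA) (hface : RatesHolderAt D R β ∧ ReadOutAt D R.u3 ∧ (0 ≤ R.u3.ρ ∧ R.u3.ρ < 1))
    (hd : ∀ r : ℝ, ∃ X : R.u3.C.Dom, r ≤ R.u3.C.d X) (hκ : 0 < R.u3.κ) {E₀ : ℝ} (hT : DecayBound R.u3.EA W E₀ R.u3.κ) :
    ¬ ∀ R' : RateCarriers N, (RatesHolderAt D R' β ∧ ReadOutAt D R'.u3 ∧ (0 ≤ R'.u3.ρ ∧ R'.u3.ρ < 1)) →
        ∃ E₀' : ℝ, 0 ≤ E₀' ∧ DecayBound R'.u3.EA W E₀' R'.u3.κ := by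
  intro H
  obtain ⟨E₀', -, h'⟩ :=
    H { R with u3 := { R.u3 with EA := fun g U X => R.u3.EA g U X + 1, EB := fun b g U X => R.u3.EB b g U X + 1 } }
      (pHolderD4Body_shift_const D R β hface 1)
  exact not_decayBound_shift_const hB hd hκ hW hT one_ne_zero E₀' h'

end NoGo

/-! ## §4 At the (t-U3) pin: what the face DOES read back -/

section AtTuple

variable {F : T4Family} {N : ℕ} [NeZero N] (𝔯 : RateReading₁₃CoPH N) (θ : Stage13HParams F N) (hP : θ.Provisos₁₃CoPH F N) (g₀ : ℕ → ℝ)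
  (os : List (ULoop F)) (ℓ : U3Letters₁₁) (hpin : (𝔯.lit F θ hP g₀ os).u3 = objectsOfRecord₁₃ F N θ.toStage13Params ℓ) (k : ℕ)

include hpin

/-- **THE FACE's ρ-ROW AT ONE TUPLE IS THE LETTER ROW `0 ≤ ℓ.ρ < 1`** [bookkeeping] (under the pin the bundle's `ρ` is `ℓ.ρ` by `rfl`, FILE 5 `rho_eq_letter`). -/
theorem rho_row_of_face_of_u3Pinned
    (hρ : 0 ≤ (rateCarriersOfRecord₁₃CoPH 𝔯 F θ hP g₀ os k).u3.ρ ∧ (rateCarriersOfRecord₁₃CoPH 𝔯 F θ hP g₀ os k).u3.ρ < 1) :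
    0 ≤ ℓ.ρ ∧ ℓ.ρ < 1 := by
  rwa [u3_rateCarriersOfRecord₁₃CoPH_of_pin 𝔯 θ hP g₀ os ℓ hpin k] at hρ

/-- **THE FACE AT THE TUPLE SUPPLIES FILE 3's SIDE LETTERS** [bookkeeping]: from `N22At` and `ReadOutAt` of the reading's bundle and its `ρ < 1`: fading memory at the letters
(`0 ≤ ℓ.C₉`), `0 ≤ ℓ.ω`, `ℓ.ω ≤ ℓ.ρ < 1`, and `N22At` of the pinned bundle. -/
theorem sideLetters_of_face_of_u3Pinned (h22 : N22At (rateCarriersOfRecord₁₃CoPH 𝔯 F θ hP g₀ os k).u3)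
    (hD4 : ReadOutAt (datumOfRecord₁₃CoPH F N θ hP) (rateCarriersOfRecord₁₃CoPH 𝔯 F θ hP g₀ os k).u3)
    (hρ1 : (rateCarriersOfRecord₁₃CoPH 𝔯 F θ hP g₀ os k).u3.ρ < 1) :
    N22At (u3OfRecord₁₃ θ.toStage13Params (objectsOfRecord₁₃ F N θ.toStage13Params ℓ) k) ∧ 0 ≤ ℓ.C₉ ∧ 0 ≤ ℓ.ω ∧ ℓ.ω < 1 := by
  rw [u3_rateCarriersOfRecord₁₃CoPH_of_pin 𝔯 θ hP g₀ os ℓ hpin k] at h22 hD4 hρ1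
  obtain ⟨⟨-, -, hω⟩, -, -, hωρ⟩ := signs_of_readOutAt hD4
  exact ⟨h22, T4BetaReadOut.fadingMemory_const_nonneg ((n22At_atPin_iff _ ℓ k).1 h22).2, hω, lt_of_le_of_lt hωρ hρ1⟩

/-- ★★ **MODULO THE FACE AT THE TUPLE, (T) AT THE RECORD WINDOW ⟺ W1's (5.10)-TYPE LETTER AT EVERY DIRECTION PAIR** [bookkeeping]: given `N22At` and `ReadOutAt` of the
reading's node-U3 bundle and `ρ < 1` (three conjuncts of `PHolderD4`'s body at `(g₀, os, k)`), and `0 < θ.γ`: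
`(∃ E₀ ≥ 0, DecayBound R.u3.EA (Window θ.γ) E₀ R.u3.κ) ↔ ∀ μ ν, KernelDecayOfRecord₁₃ F N θ μ ν (ℓ F θ).κ` — FILE 3's `decayBound_atPin_iff_kernelDecayOfRecord₁₃`, its side
letters discharged by `sideLetters_of_face_of_u3Pinned`.  The RIGHT side is a sentence about the RECORD at rate `ℓ.κ` (node W1), not about the face. -/
theorem decayBound_iff_kernelDecayOfRecord₁₃_of_face_of_u3Pinned (h22 : N22At (rateCarriersOfRecord₁₃CoPH 𝔯 F θ hP g₀ os k).u3)
    (hD4 : ReadOutAt (datumOfRecord₁₃CoPH F N θ hP) (rateCarriersOfRecord₁₃CoPH 𝔯 F θ hP g₀ os k).u3)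
    (hρ1 : (rateCarriersOfRecord₁₃CoPH 𝔯 F θ hP g₀ os k).u3.ρ < 1) (hγ : 0 < θ.γ) :
    (∃ E₀ : ℝ, 0 ≤ E₀ ∧ DecayBound (rateCarriersOfRecord₁₃CoPH 𝔯 F θ hP g₀ os k).u3.EA (Window θ.γ) E₀ (rateCarriersOfRecord₁₃CoPH 𝔯 F θ hP g₀ os k).u3.κ) ↔
      ∀ μ ν : Fin 4, KernelDecayOfRecord₁₃ F N θ.toStage13Params μ ν ℓ.κ := by
  obtain ⟨h22', hC₉, hω0, hω1⟩ := sideLetters_of_face_of_u3Pinned 𝔯 θ hP g₀ os ℓ hpin k h22 hD4 hρ1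
  rw [u3_rateCarriersOfRecord₁₃CoPH_of_pin 𝔯 θ hP g₀ os ℓ hpin k]
  exact decayBound_atPin_iff_kernelDecayOfRecord₁₃ θ.toStage13Params ℓ k h22' hC₉ hω0 hω1 hγ

/-- ★★ **THE SAME FROM THE WHOLE FACE BODY AT THE TUPLE ON AN ADMISSIBLE TUPLE** [bookkeeping]: `RatesHolderAt D R β ∧ ReadOutAt D R.u3 ∧ (0 ≤ ρ ∧ ρ < 1)` (its `N22At` conjunct,
its read-out signs, its ρ-row) and `θ.Admissible F N` (for `0 < θ.γ`) ⇒ (T) at the record window ⟺ the (5.10)-type letter at all 16 pairs. -/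
theorem decayBound_iff_kernelDecayOfRecord₁₃_of_pHolderD4Body_of_u3Pinned {β : ℝ} (hθ : θ.Admissible F N)
    (hface : RatesHolderAt (datumOfRecord₁₃CoPH F N θ hP) (rateCarriersOfRecord₁₃CoPH 𝔯 F θ hP g₀ os k) β ∧
      ReadOutAt (datumOfRecord₁₃CoPH F N θ hP) (rateCarriersOfRecord₁₃CoPH 𝔯 F θ hP g₀ os k).u3 ∧
      (0 ≤ (rateCarriersOfRecord₁₃CoPH 𝔯 F θ hP g₀ os k).u3.ρ ∧ (rateCarriersOfRecord₁₃CoPH 𝔯 F θ hP g₀ os k).u3.ρ < 1)) :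
    (∃ E₀ : ℝ, 0 ≤ E₀ ∧ DecayBound (rateCarriersOfRecord₁₃CoPH 𝔯 F θ hP g₀ os k).u3.EA (Window θ.γ) E₀ (rateCarriersOfRecord₁₃CoPH 𝔯 F θ hP g₀ os k).u3.κ) ↔
      ∀ μ ν : Fin 4, KernelDecayOfRecord₁₃ F N θ.toStage13Params μ ν ℓ.κ :=
  decayBound_iff_kernelDecayOfRecord₁₃_of_face_of_u3Pinned 𝔯 θ hP g₀ os ℓ hpin k hface.1.2.2.2.2.2 hface.2.1 hface.2.2.2 hθ.toStage9.gamma_pos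

/-- ★ **THE CONSUMERS' PER-TUPLE `hdecT` BODY («every tuning window `γ' ≤ θ.γ`») ⟺ THE SAME LETTER, MODULO THE FACE AT THE TUPLE** [bookkeeping]: (⟸) the record window
bound restricts to every `Window γ'`, `γ' ≤ θ.γ` (FILE 2 `decayBound_window_mono`); (⟹) read at `γ' = θ.γ`. -/
theorem hdecTAt_iff_kernelDecayOfRecord₁₃_of_face_of_u3Pinned (h22 : N22At (rateCarriersOfRecord₁₃CoPH 𝔯 F θ hP g₀ os k).u3)
    (hD4 : ReadOutAt (datumOfRecord₁₃CoPH F N θ hP) (rateCarriersOfRecord₁₃CoPH 𝔯 F θ hP g₀ os k).u3)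
    (hρ1 : (rateCarriersOfRecord₁₃CoPH 𝔯 F θ hP g₀ os k).u3.ρ < 1) (hγ : 0 < θ.γ) :
    (∀ γ' : ℝ, γ' ≤ θ.γ → ∃ E₀ : ℝ, 0 ≤ E₀ ∧
        DecayBound (rateCarriersOfRecord₁₃CoPH 𝔯 F θ hP g₀ os k).u3.EA (Window γ') E₀ (rateCarriersOfRecord₁₃CoPH 𝔯 F θ hP g₀ os k).u3.κ) ↔
      ∀ μ ν : Fin 4, KernelDecayOfRecord₁₃ F N θ.toStage13Params μ ν ℓ.κ := by
  rw [← decayBound_iff_kernelDecayOfRecord₁₃_of_face_of_u3Pinned 𝔯 θ hP g₀ os ℓ hpin k h22 hD4 hρ1 hγ]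
  refine ⟨fun h => h θ.γ le_rfl, fun ⟨E₀, hE₀, hd⟩ γ' hγ' => ⟨E₀, hE₀, decayBound_window_mono _ (window_mono hγ') hd⟩⟩

end AtTuple

section Pinned

variable {N : ℕ} [NeZero N] (𝔯 : RateReading₁₃CoPH N) (G : ∀ {F : T4Family}, Stage13HParams F N → Prop) (ℓ : (F : T4Family) → Stage13HParams F N → U3Letters₁₁)
  (hpin : ∀ (F : T4Family) (θ : Stage13HParams F N) (hP : θ.Provisos₁₃CoPH F N) (g₀ : ℕ → ℝ) (os : List (ULoop F)),
    (𝔯.lit F θ hP g₀ os).u3 = objectsOfRecord₁₃ F N θ.toStage13Params (ℓ F θ))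

include hpin

/-- ★ **MODULO THE FACE, THE CONSUMERS' `hunif` ⟺ THE ONE-BIT ROW `0 < ρ`** [bookkeeping]: under the per-tuple pin and given, on each guarded admissible tuple, the face's ρ-row
`0 ≤ R.u3.ρ ∧ R.u3.ρ < 1` at SOME `(g₀, os, k)` (what the closer of stub 2 holds wherever the face is not vacuous), the uniform-letters clause of the N19′ composites (VERBATIM
text, generic `N`, any guard `G`) holds IFF `∀ F θ hP, G θ → θ.Admissible F N → 0 < (ℓ F θ).ρ` — FILE 5's `hunif_iff_rho_row_of_u3Pinned` with its `ρ < 1` half READ BACK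
from the face; the face carries `0 ≤ ρ`, not `0 < ρ`. -/
theorem hunif_iff_rho_pos_of_face_of_u3Pinned
    (hface : ∀ (F : T4Family) (θ : Stage13HParams F N) (hP : θ.Provisos₁₃CoPH F N), G θ → θ.Admissible F N →
      ∃ (g₀ : ℕ → ℝ) (os : List (ULoop F)) (k : ℕ), 0 ≤ (rateCarriersOfRecord₁₃CoPH 𝔯 F θ hP g₀ os k).u3.ρ ∧ (rateCarriersOfRecord₁₃CoPH 𝔯 F θ hP g₀ os k).u3.ρ < 1) :
    (∀ (F : T4Family) (θ : Stage13HParams F N) (hP : θ.Provisos₁₃CoPH F N), G θ → θ.Admissible F N →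
      ∃ M ρ₁ : ℝ, 0 ≤ M ∧ ρ₁ < 1 ∧ ∀ (g₀ : ℕ → ℝ) (os : List (ULoop F)) (k : ℕ), 0 < (rateCarriersOfRecord₁₃CoPH 𝔯 F θ hP g₀ os k).u3.ρ ∧
        (rateCarriersOfRecord₁₃CoPH 𝔯 F θ hP g₀ os k).u3.ρ ≤ ρ₁ ∧
        (rateCarriersOfRecord₁₃CoPH 𝔯 F θ hP g₀ os k).u3.cr * (rateCarriersOfRecord₁₃CoPH 𝔯 F θ hP g₀ os k).u3.C₉ *
          (rateCarriersOfRecord₁₃CoPH 𝔯 F θ hP g₀ os k).u3.ω ≤ M) ↔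
      (∀ (F : T4Family) (θ : Stage13HParams F N), θ.Provisos₁₃CoPH F N → G θ → θ.Admissible F N → 0 < (ℓ F θ).ρ) := by
  rw [hunif_iff_rho_row_of_u3Pinned 𝔯 G ℓ hpin]
  refine ⟨fun h F θ hP hG hθ => (h F θ hP hG hθ).1, fun h F θ hP hG hθ => ⟨h F θ hP hG hθ, ?_⟩⟩
  obtain ⟨g₀, os, k, hρ⟩ := hface F θ hP hG hθ
  exact (rho_row_of_face_of_u3Pinned 𝔯 θ hP g₀ os (ℓ F θ) (hpin F θ hP g₀ os) k hρ).2

end Pinned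

/-! ## §5 At the (t-U3) pin the no-go's carrier hypotheses hold: the kernel carriers have domains of every size and a background -/

section NoGoAtPin

variable {F : T4Family} {N : ℕ} [NeZero N]

/-- **THE KERNEL CARRIERS HAVE DOMAINS OF UNBOUNDED SIZE** [folklore]: def-W1's carrier point `pt 0 0 0 z` at the constant displacement `z ≡ ⌈r⌉₊` has tree length
`|z|₁ = 4·⌈r⌉₊ ≥ r`. -/
theorem unbounded_d_atPin (θ : Stage13Params F N) (ℓ : U3Letters₁₁) (k : ℕ) (r : ℝ) :
    ∃ X : (u3OfRecord₁₃ θ (objectsOfRecord₁₃ F N θ ℓ) k).C.Dom, r ≤ (u3OfRecord₁₃ θ (objectsOfRecord₁₃ F N θ ℓ) k).C.d X := by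
  refine ⟨Node00.U3OfKernels.pt 0 0 0 fun _ => ((⌈r⌉₊ : ℕ) : ℤ), ?_⟩
  show r ≤ B12Sec2to5.l1 fun _ : Fin 4 => ((⌈r⌉₊ : ℕ) : ℤ)
  have h1 : r ≤ (⌈r⌉₊ : ℝ) := Nat.le_ceil r
  have h2 : B12Sec2to5.l1 (fun _ : Fin 4 => ((⌈r⌉₊ : ℕ) : ℤ)) = 4 * (⌈r⌉₊ : ℝ) := by
    simp [B12Sec2to5.l1, Finset.sum_const]
  rw [h2]
  have h3 : (0 : ℝ) ≤ (⌈r⌉₊ : ℝ) := Nat.cast_nonneg _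
  linarith

variable (𝔯 : RateReading₁₃CoPH N) (θ : Stage13HParams F N) (hP : θ.Provisos₁₃CoPH F N) (g₀ : ℕ → ℝ)
  (os : List (ULoop F)) (ℓ : U3Letters₁₁) (hpin : (𝔯.lit F θ hP g₀ os).u3 = objectsOfRecord₁₃ F N θ.toStage13Params ℓ) (k : ℕ)

include hpin

/-- ★★★ **THE NO-GO AT A PINNED TUPLE** [bookkeeping]: if at one tuple under the (t-U3) pin the reading's bundle carries stub 1's face body at `(datumOfRecord₁₃CoPH, β)` AND (T)
on `Window γ` (`0 < γ`), with a positive rate letter `0 < ℓ.κ`, then «face ⇒ (T) on `Window γ`» FAILS over bundles — the carriers' unbounded sizes and the `PUnit`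
background are def-W1's kernel carriers' (§5 `unbounded_d_atPin`).  CONDITIONAL on that inhabitant (A6). -/
theorem not_forall_face_imp_decayBound_of_u3Pinned {β γ : ℝ} (hγ : 0 < γ) (hκ : 0 < ℓ.κ)
    (hface : RatesHolderAt (datumOfRecord₁₃CoPH F N θ hP) (rateCarriersOfRecord₁₃CoPH 𝔯 F θ hP g₀ os k) β ∧
      ReadOutAt (datumOfRecord₁₃CoPH F N θ hP) (rateCarriersOfRecord₁₃CoPH 𝔯 F θ hP g₀ os k).u3 ∧
      (0 ≤ (rateCarriersOfRecord₁₃CoPH 𝔯 F θ hP g₀ os k).u3.ρ ∧ (rateCarriersOfRecord₁₃CoPH 𝔯 F θ hP g₀ os k).u3.ρ < 1))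
    {E₀ : ℝ} (hT : DecayBound (rateCarriersOfRecord₁₃CoPH 𝔯 F θ hP g₀ os k).u3.EA (Window γ) E₀ (rateCarriersOfRecord₁₃CoPH 𝔯 F θ hP g₀ os k).u3.κ) :
    ¬ ∀ R' : RateCarriers N, (RatesHolderAt (datumOfRecord₁₃CoPH F N θ hP) R' β ∧ ReadOutAt (datumOfRecord₁₃CoPH F N θ hP) R'.u3 ∧ (0 ≤ R'.u3.ρ ∧ R'.u3.ρ < 1)) →
        ∃ E₀' : ℝ, 0 ≤ E₀' ∧ DecayBound R'.u3.EA (Window γ) E₀' R'.u3.κ := by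
  have hu := u3_rateCarriersOfRecord₁₃CoPH_of_pin 𝔯 θ hP g₀ os ℓ hpin k
  have hB : Nonempty (rateCarriersOfRecord₁₃CoPH 𝔯 F θ hP g₀ os k).u3.C.BgA := by rw [hu]; exact ⟨PUnit.unit⟩
  have hd : ∀ r : ℝ, ∃ X : (rateCarriersOfRecord₁₃CoPH 𝔯 F θ hP g₀ os k).u3.C.Dom, r ≤ (rateCarriersOfRecord₁₃CoPH 𝔯 F θ hP g₀ os k).u3.C.d X := by
    rw [hu]; exact unbounded_d_atPin θ.toStage13Params ℓ k
  have hκ' : 0 < (rateCarriersOfRecord₁₃CoPH 𝔯 F θ hP g₀ os k).u3.κ := by rw [hu]; exact hκ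
  exact not_forall_pHolderD4Body_imp_decayBound _ β (Window γ) ⟨fun _ => γ, fun _ => ⟨hγ, le_rfl⟩⟩ _ hB hface hd hκ' hT

/-- ★★★ **… WITH (T) READ FROM W1's (5.10)-TYPE LETTER** [bookkeeping]: at a pinned tuple on an admissible tuple where stub 1's face body holds AND the record's (5.10)-type letter
holds at every direction pair at rate `0 < ℓ.κ` (so (T) holds at the record window, §4), the face STILL does not imply (T) over bundles.  The honest reading: inside
`stub_expansion13HV` the (T) input is the RECORD's letter (node W1), carried by neither stub's displayed text. -/
theorem not_forall_face_imp_decayBound_of_u3Pinned_of_kernelDecay {β : ℝ} (hθ : θ.Admissible F N) (hκ : 0 < ℓ.κ)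
    (hface : RatesHolderAt (datumOfRecord₁₃CoPH F N θ hP) (rateCarriersOfRecord₁₃CoPH 𝔯 F θ hP g₀ os k) β ∧
      ReadOutAt (datumOfRecord₁₃CoPH F N θ hP) (rateCarriersOfRecord₁₃CoPH 𝔯 F θ hP g₀ os k).u3 ∧
      (0 ≤ (rateCarriersOfRecord₁₃CoPH 𝔯 F θ hP g₀ os k).u3.ρ ∧ (rateCarriersOfRecord₁₃CoPH 𝔯 F θ hP g₀ os k).u3.ρ < 1))
    (h510 : ∀ μ ν : Fin 4, KernelDecayOfRecord₁₃ F N θ.toStage13Params μ ν ℓ.κ) :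
    ¬ ∀ R' : RateCarriers N, (RatesHolderAt (datumOfRecord₁₃CoPH F N θ hP) R' β ∧ ReadOutAt (datumOfRecord₁₃CoPH F N θ hP) R'.u3 ∧ (0 ≤ R'.u3.ρ ∧ R'.u3.ρ < 1)) →
        ∃ E₀' : ℝ, 0 ≤ E₀' ∧ DecayBound R'.u3.EA (Window θ.γ) E₀' R'.u3.κ := by
  obtain ⟨E₀, -, hT⟩ := (decayBound_iff_kernelDecayOfRecord₁₃_of_pHolderD4Body_of_u3Pinned 𝔯 θ hP g₀ os ℓ hpin k hθ hface).2 h510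
  exact not_forall_face_imp_decayBound_of_u3Pinned 𝔯 θ hP g₀ os ℓ hpin k hθ.toStage9.gamma_pos hκ hface hT

end NoGoAtPin

end Summit.QuantumFields.YangMills.BalabanUVNodes.N19U3InputsReadBackFromStub1Face

end
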